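import Summits.AtomisticToContinuum.FouriersLaw.Theorems.LocalOhmBVBVProfileBoundarySeam
import Summits.AtomisticToContinuum.FouriersLaw.Theorems.LocalOhmBVBVProfileProfileBound
import Summits.AtomisticToContinuum.FouriersLaw.Theorems.LocalOhmBVBVProfileReductions
import Summits.AtomisticToContinuum.FouriersLaw.Theorems.LocalOhmBVBVProfileBoundedBackflowKernel
import Summits.AtomisticToContinuum.FouriersLaw.Theorems.LocalOhmBVBVProfileTotalBackflowKernel

/-!
# Skeleton of line `registered` (= `Lines/birth.lean`) for crux `LocalOhmBV.BVProfile` — RESHAPED cut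
(item `stmt-AtomisticToContinuum-12012`, route `route-AtomisticToContinuum-LocalOhmBV`, shared verbatim with
`route-AtomisticToContinuum-TransferKernelPositivity`; sub-problem `FouriersLaw`; lead c3, 2026-08-17, cycle 1)

Crux (FIXED, concluded BY NAME below): for `pinnedChain ω₂ lam β γ` (all `> 0`), under weak-NESS uniqueness, along any
steady-state family `μ`, for every `T > 0` there is `C` with `Σ_bonds |θ_N(i+1) − θ_N(i)| ≤ C` for every `N` and every
kinetic-temperature response profile `θ_N` — `N`-uniform BOUNDED VARIATION of the linear-response profile.

## The cut: BOUNDARY-LAYER BOUND × BULK BACKFLOW (same composition idea as the registered birth cut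
"sup bound × bulk backflow", with the sup bound SHRUNK to the boundary layers)

Key landed fact (`Theorems/LocalOhmBVBVProfileTotalBackflowSeam.lean`, `bvProfile_of_totalBackflow`): on every bond
`|Δ| = Δ + 2Δ⁻` and the drops telescope, so `TV(θ_N) = (θ_N(0) − θ_N(N−1)) + 2·(total backflow)`, and the drop is
`≤ 1` for EVERY `N` by the landed `N`-uniform contact passivity `|θ_N(0)|, |θ_N(N−1)| ≤ 1/2` (`profileBound_contact`).
Hence NO sup bound / passivity is needed in the bulk, and the crux is EQUIVALENT to an `N`-uniform bound on the total
backflow (`stub_totalBackflow`-statement ⇔ crux; kernel form `stub_totalBackflow_iff_cutBondTotalBackflow`). The total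
backflow splits along the bulk/boundary cut into the two registered stubs:

* `stub_boundedBackflow` (OPEN, unchanged from the birth cut): `∃ ℓ K`, bulk uphill variation
  `Σ_{ℓ ≤ i, i+1+ℓ < N} (θ(i+1) − θ(i))⁺ ≤ K`. Implied by the sister crux `MonotoneProfile` (stmt-12008) with `K = 0`
  (`boundedBackflow_of_monotoneProfile`, landed); kernel form `stub_boundedBackflow_iff_cutBondBackflow` (landed).
* `stub_boundaryBound` (OPEN, NEW — replaces the everywhere sup bound `stub_profileBound`): for EVERY width `ℓ` there is
  `B` with `|t| ≤ B` for every `N`, every site within `ℓ + 1` of an end (`i ≤ ℓ ∨ N ≤ i + 1 + ℓ`) and every profile limit `t`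
  at `i` — `N`-uniform boundedness of the response NEAR THE BATHS. Implied by the old `stub_profileBound`
  (`boundaryBound_of_profileBound`) and by the sister crux `Passivity` (stmt-12010, `B = 1/2`, `boundaryBound_of_passivity`);
  true at distance `0` for every `N` (`profileBound_contact`); strictly more local than passivity.
* COMPOSITION (LANDED, `Theorems/LocalOhmBVBVProfileBoundarySeam.lean`):
  `BVProfile_of = localOhmBV_bvProfile_of_boundaryBound_of_backflow stub_boundaryBound stub_boundedBackflow`,
  `C = 1 + 2·(max K 0 + 4ℓ·max B 0)`; the conditional closure `Passivity → MonotoneProfile → BVProfile`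
  (`localOhmBV_bvProfile_of_passivity_of_monotoneProfile` = `TransferKernelPositivity.TPGlue`, landed) stands.

Why not a costume: `stub_boundedBackflow` alone allows unbounded climbs inside the boundary layers; `stub_boundaryBound`
alone allows `TV ≍ N` (bulk oscillations); the crux implies both (with `profileBound_contact`) and needs both.
Hardest stub: `stub_boundedBackflow` (no comparison / sign structure for the linearised NESS of the Langevin chain in
print). Reformulation for attackers (`Cruxes/BVProfile/LEAD-NOTES.md`): for EVERY bond `k`,
`u_N(b) = C(k,b)/T² + ([b ≤ k] − [b > k])/2`, `C(k,b) = ∫₀^∞⟨j_k(0) p_b²(t)⟩_{Gibbs_T} dt`.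
Disproof used: none on file (no `Disproof.lean`, no `Negative/` for this crux, 2026-08-17T08:45Z).
Landed for this line: p146317, p146321, p147848, p148117, p148135, p148794, p148977 (+ boundary seam p149422).
-/

noncomputable section

namespace Summit.AtomisticToContinuum.FouriersLaw.Cruxes.BVProfile.Birth

open Summit.AtomisticToContinuum.FouriersLaw.Theorems

/-! ## The two registered stubs (OPEN) -/

/-- **stub 1 — `stub_boundaryBound` (N-uniform bound on the response in boundary layers of every fixed width).**
For `pinnedChain ω₂ lam β γ` (all `> 0`), under weak-NESS uniqueness, along any steady-state family and every `T > 0`: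
for every `ℓ : ℕ` there is `B` such that for every `N`, every site `i : Fin N` with `i ≤ ℓ ∨ N ≤ i + 1 + ℓ` and every limit
`t` of `δ ↦ (μ_{N,T+δ/2,T−δ/2}(p_i²) − μ_{N,T,T}(p_i²))/δ` along `𝓝[≠] 0`: `|t| ≤ B`. Implied by `Passivity` (12010,
`B = 1/2`) and by the old everywhere sup bound; true for `ℓ`-independent `B = 1/2` at the contact sites themselves
(`profileBound_contact`). -/
theorem stub_boundaryBound : ∀ ω₂ lam β γ : ℝ, 0 < ω₂ → 0 < lam → 0 < β → 0 < γ → (∀ (N : ℕ) (T_L T_R : ℝ), 0 < T_L → 0 < T_R → ∀ μ ν : MeasureTheory.Measure (Literature.MathematicalPhysics.KineticTheory.HeatConduction.PhaseSpace N), (Literature.MathematicalPhysics.KineticTheory.HeatConduction.pinnedChain ω₂ lam β γ).IsSteadyState N T_L T_R μ → (Literature.MathematicalPhysics.KineticTheory.HeatConduction.pinnedChain ω₂ lam β γ).IsSteadyState N T_L T_R ν → μ = ν) → ∀ μ : (N : ℕ) → ℝ → ℝ → MeasureTheory.Measure (Literature.MathematicalPhysics.KineticTheory.HeatConduction.PhaseSpace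 N), (∀ (N : ℕ) (T_L T_R : ℝ), 0 < T_L → 0 < T_R → (Literature.MathematicalPhysics.KineticTheory.HeatConduction.pinnedChain ω₂ lam β γ).IsSteadyState N T_L T_R (μ N T_L T_R)) → ∀ T : ℝ, 0 < T → ∀ ℓ : ℕ, ∃ B : ℝ, ∀ (N : ℕ) (i : Fin N) (t : ℝ), (i.val ≤ ℓ ∨ N ≤ i.val + 1 + ℓ) → Filter.Tendsto (fun δ : ℝ => ((∫ x, (x.2 i) ^ 2 ∂(μ N (T + δ / 2) (T - δ / 2))) - ∫ x, (x.2 i) ^ 2 ∂(μ N T T)) / δ) (nhdsWithin 0 {(0 : ℝ)}ᶜ) (nhds t) → |t| ≤ B := by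
  sorry

/-- **stub 2 — `stub_boundedBackflow` (bounded uphill variation of the response profile in the bulk; unchanged).**
For `pinnedChain ω₂ lam β γ` (all `> 0`), under weak-NESS uniqueness, along any steady-state family and every `T > 0`
there are a boundary-layer width `ℓ : ℕ` and `K : ℝ` (independent of `N`) such that for every `N` and every response
profile `θ : Fin N → ℝ`: `Σ_i Σ_j [j = i+1 ∧ ℓ ≤ i ∧ i+1+ℓ < N] max (θ j − θ i) 0 ≤ K`. Implied by `MonotoneProfile`
(12008, `K = 0`); ⟺ the same bound for the explicit equilibrium profiles `u_N` (`stub_boundedBackflow_iff_cutBondBackflow`). -/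
theorem stub_boundedBackflow : ∀ ω₂ lam β γ : ℝ, 0 < ω₂ → 0 < lam → 0 < β → 0 < γ → (∀ (N : ℕ) (T_L T_R : ℝ), 0 < T_L → 0 < T_R → ∀ μ ν : MeasureTheory.Measure (Literature.MathematicalPhysics.KineticTheory.HeatConduction.PhaseSpace N), (Literature.MathematicalPhysics.KineticTheory.HeatConduction.pinnedChain ω₂ lam β γ).IsSteadyState N T_L T_R μ → (Literature.MathematicalPhysics.KineticTheory.HeatConduction.pinnedChain ω₂ lam β γ).IsSteadyState N T_L T_R ν → μ = ν) → ∀ μ : (N : ℕ) → ℝ → ℝ → MeasureTheory.Measure (Literature.MathematicalPhysics.KineticTheory.HeatConduction.PhaseSpace N), (∀ (N : ℕ) (T_L T_R : ℝ), 0 < T_L → 0 < T_R → (Literature.MathematicalPhysics.KineticTheory.HeatConduction.pinnedChain ω₂ lam β γ).IsSteadyState N T_L T_R (μ N T_L T_R)) → ∀ T : ℝ, 0 < T → ∃ (ℓ : ℕ) (K : ℝ), ∀ (N : ℕ) (θ : Fin N → ℝ), (∀ i : Fin N, Filter.Tendsto (fun δ : ℝ => ((∫ x, (x.2 i) ^ 2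 ∂(μ N (T + δ / 2) (T - δ / 2))) - ∫ x, (x.2 i) ^ 2 ∂(μ N T T)) / δ) (nhdsWithin 0 {(0 : ℝ)}ᶜ) (nhds (θ i))) → ∑ i : Fin N, ∑ j : Fin N, (if j.val = i.val + 1 ∧ ℓ ≤ i.val ∧ i.val + 1 + ℓ < N then max (θ j - θ i) 0 else 0) ≤ K := by
  sorry

/-! ## The composition (landed seam) -/

/-- **Skeleton theorem — the crux `LocalOhmBV.BVProfile` BY NAME from the two registered stubs**, through the landed
unconditional seam `localOhmBV_bvProfile_of_boundaryBound_of_backflow` (its only `sorry`s are the two stubs). -/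
theorem BVProfile_of :
    _root_.Summit.AtomisticToContinuum.FouriersLaw.Theses.LocalOhmBV.BVProfile :=
  localOhmBV_bvProfile_of_boundaryBound_of_backflow stub_boundaryBound stub_boundedBackflow

/-- **Skeleton theorem, sister-route name** — the same crux as `TransferKernelPositivity.BVProfile` (shared item). -/
theorem BVProfile_proof :
    _root_.Summit.AtomisticToContinuum.FouriersLaw.Theses.TransferKernelPositivity.BVProfile :=
  transferKernelPositivity_bvProfile_of_boundaryBound_of_backflow stub_boundaryBound stub_boundedBackflow

/-! ## Landed links (documentation; no sorry below this line) -/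

/-- The two vetted sister cruxes imply the two stubs (`Passivity` ⇒ stub 1 with `B = 1/2`; `MonotoneProfile` ⇒ stub 2
with `K = 0`), hence the crux (`= TransferKernelPositivity.TPGlue`). -/
example (hP : _root_.Summit.AtomisticToContinuum.FouriersLaw.Theses.TransferKernelPositivity.Passivity)
    (hM : _root_.Summit.AtomisticToContinuum.FouriersLaw.Theses.TransferKernelPositivity.MonotoneProfile) :
    _root_.Summit.AtomisticToContinuum.FouriersLaw.Theses.LocalOhmBV.BVProfile :=
  localOhmBV_bvProfile_of_boundaryBound_of_backflow (boundaryBound_of_passivity hP)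
    (boundedBackflow_of_monotoneProfile hM)

/-- The old everywhere sup bound (birth stub `stub_profileBound`) implies the new boundary stub. -/
example (hPB : ∀ ω₂ lam β γ : ℝ, 0 < ω₂ → 0 < lam → 0 < β → 0 < γ → (∀ (N : ℕ) (T_L T_R : ℝ), 0 < T_L → 0 < T_R → ∀ μ ν : MeasureTheory.Measure (Literature.MathematicalPhysics.KineticTheory.HeatConduction.PhaseSpace N), (Literature.MathematicalPhysics.KineticTheory.HeatConduction.pinnedChain ω₂ lam β γ).IsSteadyState N T_L T_R μ → (Literature.MathematicalPhysics.KineticTheory.HeatConduction.pinnedChain ω₂ lam β γ).IsSteadyState N T_L T_R ν → μ = ν) → ∀ μ : (N : ℕ) → ℝ → ℝ → MeasureTheory.Measure (Literature.MathematicalPhysics.KineticTheory.HeatConduction.PhaseSpace N), (∀ (N : ℕ) (T_L T_R : ℝ), 0 < T_L → 0 < T_R → (Literature.MathematicalPhysics.KineticTheory.HeatConduction.pinnedChain ω₂ lam β γ).IsSteadyState N T_L T_R (μ N T_L T_R)) → ∀ T : ℝ, 0 < T → ∃ B : ℝ, ∀ (N : ℕ) (i : Fin N) (t : ℝ), Filter.Tendsto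 (fun δ : ℝ => ((∫ x, (x.2 i) ^ 2 ∂(μ N (T + δ / 2) (T - δ / 2))) - ∫ x, (x.2 i) ^ 2 ∂(μ N T T)) / δ) (nhdsWithin 0 {(0 : ℝ)}ᶜ) (nhds t) → |t| ≤ B) :
    ∀ ω₂ lam β γ : ℝ, 0 < ω₂ → 0 < lam → 0 < β → 0 < γ → (∀ (N : ℕ) (T_L T_R : ℝ), 0 < T_L → 0 < T_R → ∀ μ ν : MeasureTheory.Measure (Literature.MathematicalPhysics.KineticTheory.HeatConduction.PhaseSpace N), (Literature.MathematicalPhysics.KineticTheory.HeatConduction.pinnedChain ω₂ lam β γ).IsSteadyState N T_L T_R μ → (Literature.MathematicalPhysics.KineticTheory.HeatConduction.pinnedChain ω₂ lam β γ).IsSteadyState N T_L T_R ν → μ = ν) → ∀ μ : (N : ℕ) → ℝ → ℝ → MeasureTheory.Measure (Literature.MathematicalPhysics.KineticTheory.HeatConduction.PhaseSpace N), (∀ (N : ℕ) (T_L T_R : ℝ), 0 < T_L → 0 < T_R → (Literature.MathematicalPhysics.KineticTheory.HeatConduction.pinnedChain ω₂ lam β γ).IsSteadyState N T_L T_R (μ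 N T_L T_R)) → ∀ T : ℝ, 0 < T → ∀ ℓ : ℕ, ∃ B : ℝ, ∀ (N : ℕ) (i : Fin N) (t : ℝ), (i.val ≤ ℓ ∨ N ≤ i.val + 1 + ℓ) → Filter.Tendsto (fun δ : ℝ => ((∫ x, (x.2 i) ^ 2 ∂(μ N (T + δ / 2) (T - δ / 2))) - ∫ x, (x.2 i) ^ 2 ∂(μ N T T)) / δ) (nhdsWithin 0 {(0 : ℝ)}ᶜ) (nhds t) → |t| ≤ B :=
  boundaryBound_of_profileBound hPB

/-- The crux-equivalent one-stub form: an `N`-uniform bound on the TOTAL backflow already gives the crux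
(`localOhmBV_bvProfile_of_totalBackflow`, landed), and the two registered stubs give the total backflow
(`totalBackflow_of_boundaryBound_of_backflow`, landed). -/
example (hTB : ∀ ω₂ lam β γ : ℝ, 0 < ω₂ → 0 < lam → 0 < β → 0 < γ → (∀ (N : ℕ) (T_L T_R : ℝ), 0 < T_L → 0 < T_R → ∀ μ ν : MeasureTheory.Measure (Literature.MathematicalPhysics.KineticTheory.HeatConduction.PhaseSpace N), (Literature.MathematicalPhysics.KineticTheory.HeatConduction.pinnedChain ω₂ lam β γ).IsSteadyState N T_L T_R μ → (Literature.MathematicalPhysics.KineticTheory.HeatConduction.pinnedChain ω₂ lam β γ).IsSteadyState N T_L T_R ν → μ = ν) → ∀ μ : (N : ℕ) → ℝ → ℝ → MeasureTheory.Measure (Literature.MathematicalPhysics.KineticTheory.HeatConduction.PhaseSpace N), (∀ (N : ℕ) (T_L T_R : ℝ), 0 < T_L → 0 < T_R → (Literature.MathematicalPhysics.KineticTheory.HeatConduction.pinnedChain ω₂ lam β γ).IsSteadyState N T_L T_R (μ N T_L T_R)) → ∀ T : ℝ, 0 < T → ∃ K : ℝ, ∀ (N : ℕ) (θ : Fin N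 → ℝ), (∀ i : Fin N, Filter.Tendsto (fun δ : ℝ => ((∫ x, (x.2 i) ^ 2 ∂(μ N (T + δ / 2) (T - δ / 2))) - ∫ x, (x.2 i) ^ 2 ∂(μ N T T)) / δ) (nhdsWithin 0 {(0 : ℝ)}ᶜ) (nhds (θ i))) → ∑ i : Fin N, ∑ j : Fin N, (if j.val = i.val + 1 then max (θ j - θ i) 0 else 0) ≤ K) :
    _root_.Summit.AtomisticToContinuum.FouriersLaw.Theses.LocalOhmBV.BVProfile :=
  localOhmBV_bvProfile_of_totalBackflow hTB

/-- The kernel forms are in the tree (recorded by name so the skeleton's cone shows them). -/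
example : True := by
  have _h1 := @stub_profileBound_iff_cutBondBound
  have _h2 := @stub_boundedBackflow_iff_cutBondBackflow
  have _h3 := @stub_totalBackflow_iff_cutBondTotalBackflow
  trivial

end Summit.AtomisticToContinuum.FouriersLaw.Cruxes.BVProfile.Birth

end
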